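import Literature.Analysis.Complex.WirtingerMollification
import Literature.Analysis.Complex.LocallyUniformLimitSCV
import Literature.Analysis.Complex.PolydiscWeightedMeanValue
import Mathlib.Analysis.SpecialFunctions.SmoothTransition
import Mathlib.MeasureTheory.Measure.OpenPos
import HarnessLib

/-!
# Weyl's lemma for `∂̄` in several complex variables

Layer `Literature/Analysis/Complex`; the several-variable companion of `WeylLemmaDbar`
(one variable, by the Cauchy transform). On `ℂ^ι` (sup norm, Lebesgue measure):

**Theorem** (`weyl_dbar_scv`). If `U ⊆ ℂ^ι` is open and `f` is locally integrable on `U` with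
`∫ f · ∂̄_j φ dλ = 0` for all `j` and all smooth `φ` compactly supported in `U`, then `f = g` a.e. on
`U` for one holomorphic `g` on `U` (Hörmander, *ALPDO I* Thm. 4.4.1 for the elliptic system `∂̄`;
*SCV* (1973), proof of Thm. 4.2.5/Cor. 4.2.6).

Proof by Friedrichs mollifiers (no fundamental solution is needed): `f_ε = f ⋆ ρ_ε` is smooth with
`∂̄_j f_ε = (∂̄_j f) ⋆ ρ_ε = 0` (the weak equation tested against `y ↦ ρ_ε(x - y)`,
`WirtingerMollification.dbarAlong_convolution`), hence holomorphic
(`differentiableAt_complex_of_dbarAlong_eq_zero`: a real-differentiable map with `∂̄_j = 0` for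
all `j` has complex-linear differential); by the polydisc mean value property
(`PolydiscWeightedMeanValue.integral_pi_radial_smul_eq_smul`) `sup_K |h| ≤ C ∫ |h|` for
holomorphic `h` (`norm_le_mul_integral_of_differentiableOn`), so `f_ε → f` in `L¹`
(`FunctionSpaces.tendsto_eLpNorm_normed_convolution_sub_self`) makes `(f_ε)` uniformly Cauchy on
compact sets; the locally uniform limit is holomorphic (`SCV.differentiableOn_of_tendstoLocallyUniformlyOn`)
and equals `f` a.e.; the local representatives patch as in `WeylLemmaDbar.weyl_dbar`.

Everything is proved; no named facts.

## References

* L. Hörmander, *The Analysis of Linear Partial Differential Operators I*, Thm. 4.4.1;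
  *An Introduction to Complex Analysis in Several Variables* (1973), §4.2 (Cor. 4.2.6). [HormanderSCV1973]
* H. Weyl, The method of orthogonal projection in potential theory, Duke Math. J. 7 (1940).

#harness_tags complex_analysis.several_variables, complex_analysis.l2_estimates, pde.elliptic_regularity
-/

noncomputable section

open scoped Topology ComplexConjugate ENNReal Convolution ContDiff
open Set Filter Function Complex MeasureTheory Metric ContinuousLinearMap

namespace Literature.Analysis.Complex

namespace WeylSCV

variable {ι : Type} [Fintype ι] [DecidableEq ι]

/-! ### Complex differentiability from `∂̄_j = 0` -/

omit [Fintype ι] in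
/-- Decomposition of a complex multiple of a coordinate vector into real multiples of `e_j` and
`I e_j`. [folklore] -/
theorem single_eq_re_smul_add_im_smul (j : ι) (c : ℂ) :
    (Pi.single j c : ι → ℂ) = (c.re : ℝ) • (Pi.single j 1 : ι → ℂ) + (c.im : ℝ) • (I • (Pi.single j 1 : ι → ℂ)) := by
  ext k
  by_cases hk : k = j
  · subst hk
    simp only [Pi.single_eq_same, Pi.add_apply, Pi.smul_apply, real_smul, smul_eq_mul, mul_one]
    exact (re_add_im c).symm
  · simp [Pi.single_eq_of_ne hk]

/-- **A real-differentiable function with `∂̄_j f = 0` for all `j` is complex-differentiable**: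
its real differential `L` satisfies `L(I e_j) = I L(e_j)`, hence is complex-linear.
[cite: HormanderSCV1973, §2.1 (p. 23, holomorphic = `C¹` solutions of `∂̄ u = 0`)] -/
theorem differentiableAt_complex_of_dbarAlong_eq_zero {f : (ι → ℂ) → ℂ} {x : ι → ℂ} (hf : DifferentiableAt ℝ f x)
    (h : ∀ j, dbarAlong (Pi.single j 1) f x = 0) : DifferentiableAt ℂ f x := by
  set L := fderiv ℝ f x with hL
  have hI : ∀ j, L (I • Pi.single j 1) = I * L (Pi.single j 1) := fun j ↦ by
    have := h j
    rw [dbarAlong_apply, smul_eq_mul] at this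
    have h2 : L (Pi.single j 1) + I * L (I • Pi.single j 1) = 0 := by
      have := congrArg (fun z ↦ (2 : ℂ) * z) this
      simpa [mul_add, ← mul_assoc] using this
    have h3 : L (I • Pi.single j 1) = -(L (Pi.single j 1)) / I := by
      field_simp
      linear_combination h2
    rw [h3, div_I]
    ring
  have hsingle : ∀ j (c : ℂ), L (Pi.single j c) = c * L (Pi.single j 1) := fun j c ↦ by
    rw [single_eq_re_smul_add_im_smul j c, map_add, L.map_smul, L.map_smul, hI j]
    simp only [real_smul]
    have hc : (c.re : ℂ) + (c.im : ℂ) * I = c := re_add_im c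
    linear_combination (L (Pi.single j 1)) * hc
  -- the complex-linear candidate
  set L' : (ι → ℂ) →L[ℂ] ℂ := ∑ j, (L (Pi.single j 1)) • ContinuousLinearMap.proj j with hL'
  refine (differentiableAt_iff_restrictScalars ℝ hf).2 ⟨L', ?_⟩
  ext v
  rw [ContinuousLinearMap.coe_restrictScalars', hL']
  simp only [_root_.sum_apply, _root_.smul_apply, ContinuousLinearMap.proj_apply, smul_eq_mul]
  conv_rhs => rw [show v = ∑ j, Pi.single j (v j) from (Finset.univ_sum_single v).symm]
  rw [map_sum]
  exact Finset.sum_congr rfl fun j _ ↦ by rw [← hL, hsingle j (v j)]; ring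

/-- **Smooth solutions of `∂̄ u = 0` are holomorphic** on an open set. [cite: HormanderSCV1973, §2.1 (p. 23)] -/
theorem differentiableOn_complex_of_dbarAlong_eq_zero {f : (ι → ℂ) → ℂ} {V : Set (ι → ℂ)} (hV : IsOpen V)
    (hf : DifferentiableOn ℝ f V) (h : ∀ x ∈ V, ∀ j, dbarAlong (Pi.single j 1) f x = 0) : DifferentiableOn ℂ f V :=
  fun x hx ↦ (differentiableAt_complex_of_dbarAlong_eq_zero (hf.differentiableAt (hV.mem_nhds hx)) (h x hx)).differentiableWithinAt

/-! ### The mean value estimate `|h(z₀)| ≤ C ∫_{B̄(z₀,R)} |h|` -/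

/-- A continuous radial profile: `1` on `[0, R/4]`, `0` on `[R/2, ∞)`, values in `[0, 1]`. [folklore] -/
def profile (R : ℝ) (t : ℝ) : ℝ := Real.smoothTransition (2 - 4 * t / R)

omit [Fintype ι] [DecidableEq ι] in
/-- Properties of the profile: continuity, values in `[0, 1]`, `= 0` beyond `R/2`, `= 1` below `R/4`. [folklore] -/
theorem profile_props {R : ℝ} (hR : 0 < R) :
    Continuous (profile R) ∧ (∀ t, 0 ≤ profile R t) ∧ (∀ t, profile R t ≤ 1) ∧
      (∀ t, R / 2 ≤ t → profile R t = 0) ∧ (∀ t, t ≤ R / 4 → profile R t = 1) := by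
  refine ⟨Real.smoothTransition.continuous.comp (by fun_prop), fun t ↦ Real.smoothTransition.nonneg _,
    fun t ↦ Real.smoothTransition.le_one _, fun t ht ↦ Real.smoothTransition.zero_of_nonpos ?_,
    fun t ht ↦ Real.smoothTransition.one_of_one_le ?_⟩
  · rw [sub_nonpos, le_div_iff₀ hR]; linarith
  · have : 4 * t / R ≤ 1 := by rw [div_le_iff₀ hR]; linarith
    linarith

omit [Fintype ι] [DecidableEq ι] in
/-- The profile has positive mass on `ℂ`. [folklore] -/
theorem integral_profile_pos {R : ℝ} (hR : 0 < R) : 0 < ∫ w : ℂ, profile R ‖w‖ := by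
  obtain ⟨hc, h0, h1, hz, hone⟩ := profile_props hR
  have hint : Integrable (fun w : ℂ ↦ profile R ‖w‖) := by
    refine (hc.comp continuous_norm).integrable_of_hasCompactSupport ?_
    refine HasCompactSupport.intro (isCompact_closedBall (0 : ℂ) (R / 2)) fun w hw ↦ hz _ ?_
    rw [mem_closedBall, dist_zero_right, not_le] at hw
    exact hw.le
  have hle : ∫ w in closedBall (0 : ℂ) (R / 4), (1 : ℝ) ≤ ∫ w : ℂ, profile R ‖w‖ := by
    calc ∫ w in closedBall (0 : ℂ) (R / 4), (1 : ℝ) = ∫ w in closedBall (0 : ℂ) (R / 4), profile R ‖w‖ :=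
          setIntegral_congr_fun measurableSet_closedBall fun w hw ↦ (hone _ (by simpa [dist_zero_right] using hw)).symm
      _ ≤ _ := setIntegral_le_integral hint (ae_of_all _ fun w ↦ h0 _)
  refine lt_of_lt_of_le ?_ hle
  rw [setIntegral_const, smul_eq_mul, mul_one]
  exact ENNReal.toReal_pos (measure_closedBall_pos volume _ (by positivity)).ne' measure_closedBall_lt_top.ne

/-- **The mean value estimate in `ℂ^ι`**: there is `C = C(ι, R)` with `|h(z₀)| ≤ C ∫_{B̄(z₀, R)} |h| dλ`
for every `h` holomorphic on a neighbourhood of the closed polydisc `B̄(z₀, R)` (sup norm).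
[cite: HormanderSCV1973, Thm 2.2.1 / (1.1.6)'] -/
theorem exists_meanValue_const {R : ℝ} (hR : 0 < R) :
    ∃ C : ℝ, 0 < C ∧ ∀ (h : (ι → ℂ) → ℂ) (V : Set (ι → ℂ)), IsOpen V → DifferentiableOn ℂ h V →
      ∀ z₀, closedBall z₀ R ⊆ V → ‖h z₀‖ ≤ C * ∫ z in closedBall z₀ R, ‖h z‖ := by
  obtain ⟨hc, h0, h1, hz, -⟩ := profile_props hR
  set N : ℕ := Fintype.card ι with hN
  set σ : ι ≃ Fin N := Fintype.equivFin ι with hσ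
  set c : ℝ := ∫ w : ℂ, profile R ‖w‖ with hcdef
  have hcpos : 0 < c := integral_profile_pos hR
  refine ⟨(c ^ N)⁻¹, by positivity, fun h V hV hh z₀ hz₀ ↦ ?_⟩
  -- the reindexing `T : ℂ^N ≃ ℂ^ι`
  set T : (Fin N → ℂ) ≃ᵐ (ι → ℂ) := MeasurableEquiv.piCongrLeft (fun _ ↦ ℂ) σ.symm with hT
  have hTapply : ∀ (w : Fin N → ℂ) (k : ι), T w k = w (σ k) := fun w k ↦ by
    have := MeasurableEquiv.piCongrLeft_apply_apply (β := fun _ ↦ ℂ) σ.symm w (σ k)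
    simpa [hT] using this
  have hsum : ∀ w : Fin N → ℂ, ∑ i, w i • (Pi.single (σ.symm i) 1 : ι → ℂ) = T w := fun w ↦ by
    ext k
    rw [hTapply, Finset.sum_apply, Finset.sum_eq_single (σ k) (fun i _ hi ↦ ?_) (fun hk ↦ (hk (Finset.mem_univ _)).elim)]
    · simp
    · have : σ.symm i ≠ k := fun h' ↦ hi (by rw [← h', Equiv.apply_symm_apply])
      simp [Pi.single_eq_of_ne' this]
  have hTnorm : ∀ w : Fin N → ℂ, ‖T w‖ = ‖w‖ := fun w ↦ by
    refine le_antisymm ((pi_norm_le_iff_of_nonneg (norm_nonneg _)).2 fun k ↦ by rw [hTapply]; exact norm_le_pi_norm _ _)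
      ((pi_norm_le_iff_of_nonneg (norm_nonneg _)).2 fun i ↦ ?_)
    have := norm_le_pi_norm (T w) (σ.symm i)
    rwa [hTapply, Equiv.apply_symm_apply] at this
  have hTmp : MeasurePreserving T volume volume := volume_measurePreserving_piCongrLeft (fun _ ↦ ℂ) σ.symm
  -- the mean value property
  have hmem : ∀ w : Fin N → ℂ, (∀ i, ‖w i‖ ≤ R) → z₀ + ∑ i, w i • (Pi.single (σ.symm i) 1 : ι → ℂ) ∈ V := by
    intro w hw
    refine hz₀ ?_
    rw [hsum, mem_closedBall, dist_eq_norm, add_sub_cancel_left, hTnorm]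
    exact (pi_norm_le_iff_of_nonneg hR.le).2 hw
  have hmv := integral_pi_radial_smul_eq_smul (F := ℂ) hc (R₁ := R / 2) (R := R) (by positivity) (by linarith) hz hh N z₀
    (fun i ↦ Pi.single (σ.symm i) 1) hmem
  simp_rw [hsum] at hmv
  -- `‖h z₀‖ c^N ≤ ∫ 1_{B̄} ‖h‖`
  have hbound : ∀ w : Fin N → ℂ, ‖(∏ i, profile R ‖w i‖) • h (z₀ + T w)‖ ≤
      (closedBall z₀ R).indicator (fun z ↦ ‖h z‖) (z₀ + T w) := by
    intro w
    by_cases hw : ∀ i, ‖w i‖ < R / 2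
    · have hmemB : z₀ + T w ∈ closedBall z₀ R := by
        rw [mem_closedBall, dist_eq_norm, add_sub_cancel_left, hTnorm]
        exact (pi_norm_le_iff_of_nonneg hR.le).2 fun i ↦ by linarith [hw i]
      rw [indicator_of_mem hmemB, norm_smul, Real.norm_of_nonneg (Finset.prod_nonneg fun i _ ↦ h0 _)]
      exact mul_le_of_le_one_left (norm_nonneg _) (Finset.prod_le_one (fun i _ ↦ h0 _) fun i _ ↦ h1 _)
    · simp only [not_forall, not_lt] at hw
      obtain ⟨i, hi⟩ := hw
      rw [Finset.prod_eq_zero (Finset.mem_univ i) (hz _ hi), zero_smul, norm_zero]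
      exact indicator_nonneg (fun _ _ ↦ norm_nonneg _) _
  have hcont : ContinuousOn h (closedBall z₀ R) := hh.continuousOn.mono hz₀
  have hintB : IntegrableOn (fun z ↦ ‖h z‖) (closedBall z₀ R) volume :=
    (hcont.norm.integrableOn_compact (isCompact_closedBall _ _))
  have hchange : ∫ w : Fin N → ℂ, (closedBall z₀ R).indicator (fun z ↦ ‖h z‖) (z₀ + T w) = ∫ z in closedBall z₀ R, ‖h z‖ := by
    rw [← integral_indicator measurableSet_closedBall]
    have h1 := hTmp.integral_comp' (g := fun z ↦ (closedBall z₀ R).indicator (fun z ↦ ‖h z‖) (z₀ + z))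
    rw [h1]
    exact integral_add_left_eq_self (fun z ↦ (closedBall z₀ R).indicator (fun z ↦ ‖h z‖) z) z₀
  calc ‖h z₀‖ = (c ^ N)⁻¹ * ‖(c ^ N : ℝ) • h z₀‖ := by
        rw [norm_smul, Real.norm_of_nonneg (by positivity), ← mul_assoc, inv_mul_cancel₀ (by positivity)]
        ring
    _ = (c ^ N)⁻¹ * ‖∫ w : Fin N → ℂ, (∏ i, profile R ‖w i‖) • h (z₀ + T w)‖ := by
        rw [← hmv, hcdef]
    _ ≤ (c ^ N)⁻¹ * ∫ w : Fin N → ℂ, ‖(∏ i, profile R ‖w i‖) • h (z₀ + T w)‖ :=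
        mul_le_mul_of_nonneg_left (norm_integral_le_integral_norm _) (by positivity)
    _ ≤ (c ^ N)⁻¹ * ∫ w : Fin N → ℂ, (closedBall z₀ R).indicator (fun z ↦ ‖h z‖) (z₀ + T w) := by
        refine mul_le_mul_of_nonneg_left (integral_mono_of_nonneg (ae_of_all _ fun w ↦ norm_nonneg _) ?_ (ae_of_all _ hbound))
          (by positivity)
        have h2 : Integrable (fun z : ι → ℂ ↦ (closedBall z₀ R).indicator (fun z ↦ ‖h z‖) (z₀ + z)) volume :=
          (hintB.integrable_indicator measurableSet_closedBall).comp_add_left z₀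
        exact (hTmp.integrable_comp_emb T.measurableEmbedding).2 h2
    _ = (c ^ N)⁻¹ * ∫ z in closedBall z₀ R, ‖h z‖ := by rw [hchange]

/-! ### Weyl's lemma on polydiscs -/

/-- `∫ ‖g‖ → 0` from `eLpNorm g 1 → 0`. [folklore] -/
theorem tendsto_integral_norm_of_tendsto_eLpNorm {α : Type*} [MeasurableSpace α] {μ : Measure α} {g : ℕ → α → ℂ}
    (hg : ∀ n, AEStronglyMeasurable (g n) μ) (h : Tendsto (fun n ↦ eLpNorm (g n) 1 μ) atTop (𝓝 0)) :
    Tendsto (fun n ↦ ∫ x, ‖g n x‖ ∂μ) atTop (𝓝 0) := by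
  have h1 : ∀ n, ∫ x, ‖g n x‖ ∂μ = (eLpNorm (g n) 1 μ).toReal := fun n ↦ by
    rw [integral_norm_eq_lintegral_enorm (hg n), eLpNorm_one_eq_lintegral_enorm]
  simp_rw [h1]
  have := (ENNReal.tendsto_toReal ENNReal.zero_ne_top).comp h
  rwa [ENNReal.toReal_zero] at this

/-- **Weyl's lemma for `∂̄` in `ℂ^ι` (local form).** If `f` is integrable on the closed polydisc
`B̄(z₀, 3R)` with `∫ f · ∂̄_j φ = 0` for all `j` and every smooth `φ` compactly supported in
`B̄(z₀, 3R)`, then `f = g` a.e. on `B(z₀, R)` for some `g` holomorphic on `B(z₀, 3R/2)`.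
[cite: HormanderSCV1973, §4.2 (Cor. 4.2.6); ALPDO I Thm 4.4.1] -/
theorem weyl_dbar_scv_ball {f : (ι → ℂ) → ℂ} {z₀ : ι → ℂ} {R : ℝ} (hR : 0 < R)
    (hf : IntegrableOn f (closedBall z₀ (3 * R)))
    (h : ∀ φ : (ι → ℂ) → ℂ, ContDiff ℝ ∞ φ → HasCompactSupport φ →
      tsupport φ ⊆ closedBall z₀ (3 * R) → ∀ j, ∫ z, f z * dbarAlong (Pi.single j 1) φ z = 0) :
    ∃ g : (ι → ℂ) → ℂ, DifferentiableOn ℂ g (ball z₀ (3 * R / 2)) ∧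
      ∀ᵐ z ∂volume, z ∈ ball z₀ R → f z = g z := by
  -- truncation
  set F : (ι → ℂ) → ℂ := (closedBall z₀ (5 * R / 2)).indicator f with hFdef
  have hFint : Integrable F volume :=
    (hf.mono_set (closedBall_subset_closedBall (by linarith))).integrable_indicator measurableSet_closedBall
  have hFloc : LocallyIntegrable F volume := hFint.locallyIntegrable
  -- bumps of radius `< R/4`
  have hβaux : ∀ n : ℕ, R / (8 * (n + 2)) < R / (4 * (n + 2)) := fun n ↦
    div_lt_div_of_pos_left hR (by positivity) (by nlinarith)
  set β : ℕ → ContDiffBump (0 : ι → ℂ) := fun n ↦ ⟨R / (8 * (n + 2)), R / (4 * (n + 2)), by positivity, hβaux n⟩ with hβ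
  have hβout : ∀ n, (β n).rOut = R / (4 * (n + 2)) := fun n ↦ rfl
  have hβlt : ∀ n, (β n).rOut < R / 4 := fun n ↦ by
    rw [hβout]; exact div_lt_div_of_pos_left hR (by positivity) (by nlinarith)
  have hβtend : Tendsto (fun n ↦ (β n).rOut) atTop (𝓝 0) := by
    simp_rw [hβout]
    have h4 : Tendsto (fun n : ℕ ↦ 4 * ((n : ℝ) + 2)) atTop atTop :=
      Tendsto.const_mul_atTop (by norm_num) (tendsto_natCast_atTop_atTop.atTop_add tendsto_const_nhds)
    exact tendsto_const_nhds.div_atTop h4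
  -- the mollified functions
  set u : ℕ → (ι → ℂ) → ℂ := fun n ↦ (β n).normed volume ⋆[lsmul ℝ ℝ, volume] F with hu
  have husmooth : ∀ n, ContDiff ℝ ∞ (u n) := fun n ↦
    WirtingerMollification.contDiff_convolution (β n).contDiff_normed (β n).hasCompactSupport_normed hFloc
  have huint : ∀ n, Integrable (u n) volume := fun n ↦
    (((β n).contDiff_normed (n := 0)).continuous.integrable_of_hasCompactSupport (β n).hasCompactSupport_normed).integrable_convolution _ hFint
  -- `∂̄_j u_n = 0` on `B(z₀, 9R/4)`: the weak equation tested against `y ↦ ρ_n(x - y)`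
  have hdbar : ∀ n, ∀ x ∈ ball z₀ (9 * R / 4), ∀ j, dbarAlong (Pi.single j 1) (u n) x = 0 := by
    intro n x hx j
    rw [hu, WirtingerMollification.dbarAlong_convolution ((β n).contDiff_normed (n := 1)) (β n).hasCompactSupport_normed hFloc,
      neg_eq_zero]
    set W : (ι → ℂ) → ℂ := fun y ↦ ((β n).normed volume (x - y) : ℂ) with hW
    have hWs : ContDiff ℝ ∞ W := WirtingerMollification.contDiff_ofReal_comp_sub (β n).contDiff_normed x
    have hWc : HasCompactSupport W := WirtingerMollification.hasCompactSupport_ofReal_comp_sub (β n).hasCompactSupport_normed x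
    have hWsupp : tsupport W ⊆ closedBall x (β n).rOut :=
      WirtingerMollification.tsupport_ofReal_comp_sub_subset (by rw [(β n).tsupport_normed_eq]) x
    have hWsupp' : tsupport W ⊆ ball z₀ (5 * R / 2) := hWsupp.trans fun y hy ↦ by
      rw [mem_closedBall] at hy
      rw [mem_ball] at hx ⊢
      calc dist y z₀ ≤ dist y x + dist x z₀ := dist_triangle _ _ _
        _ < R / 4 + 9 * R / 4 := add_lt_add_of_le_of_lt (hy.trans (hβlt n).le) hx
        _ = 5 * R / 2 := by ring
    have hdb0 : ∀ y ∉ tsupport W, dbarAlong (Pi.single j 1) W y = 0 := fun y hy ↦ by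
      have : fderiv ℝ W y = 0 := by
        by_contra hne
        exact hy (support_fderiv_subset ℝ (mem_support.2 hne))
      simp [dbarAlong_apply, this]
    have hFf : ∀ y, F y * dbarAlong (Pi.single j 1) W y = f y * dbarAlong (Pi.single j 1) W y := fun y ↦ by
      by_cases hy : y ∈ tsupport W
      · rw [hFdef, indicator_of_mem (ball_subset_closedBall (hWsupp' hy))]
      · rw [hdb0 y hy, mul_zero, mul_zero]
    rw [integral_congr_ae (ae_of_all _ hFf)]
    exact h W hWs hWc (hWsupp'.trans (ball_subset_closedBall.trans (closedBall_subset_closedBall (by linarith)))) j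
  have hhol : ∀ n, DifferentiableOn ℂ (u n) (ball z₀ (9 * R / 4)) := fun n ↦
    differentiableOn_complex_of_dbarAlong_eq_zero isOpen_ball ((husmooth n).differentiable (by simp)).differentiableOn (hdbar n)
  -- `u_n → F` in `L¹`
  have hL1 : Tendsto (fun n ↦ eLpNorm (u n - F) 1 volume) atTop (𝓝 0) :=
    FunctionSpaces.tendsto_eLpNorm_normed_convolution_sub_self (μ := volume) (φ := β) hβtend le_rfl ENNReal.one_ne_top
      (memLp_one_iff_integrable.2 hFint)
  have hL1' : Tendsto (fun n ↦ ∫ z, ‖u n z - F z‖) atTop (𝓝 0) :=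
    tendsto_integral_norm_of_tendsto_eLpNorm (fun n ↦ ((huint n).sub hFint).aestronglyMeasurable) hL1
  -- uniform Cauchy on `B̄(z₀, 2R)` by the mean value estimate with radius `R/8`
  obtain ⟨C, hC0, hC⟩ := exists_meanValue_const (ι := ι) (R := R / 8) (by positivity)
  have hsup : ∀ n m, ∀ x ∈ closedBall z₀ (2 * R), ‖u n x - u m x‖ ≤ C * ((∫ z, ‖u n z - F z‖) + ∫ z, ‖u m z - F z‖) := by
    intro n m x hx
    have hsub : closedBall x (R / 8) ⊆ ball z₀ (9 * R / 4) := fun y hy ↦ by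
      rw [mem_closedBall] at hy hx
      rw [mem_ball]
      calc dist y z₀ ≤ dist y x + dist x z₀ := dist_triangle _ _ _
        _ ≤ R / 8 + 2 * R := add_le_add hy hx
        _ < 9 * R / 4 := by linarith
    have h1 := hC (fun z ↦ u n z - u m z) _ isOpen_ball ((hhol n).sub (hhol m)) x hsub
    refine h1.trans (mul_le_mul_of_nonneg_left ?_ hC0.le)
    have hint : Integrable (fun z ↦ u n z - u m z) volume := (huint n).sub (huint m)
    calc ∫ z in closedBall x (R / 8), ‖u n z - u m z‖ ≤ ∫ z, ‖u n z - u m z‖ :=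
          setIntegral_le_integral hint.norm (ae_of_all _ fun z ↦ norm_nonneg _)
      _ ≤ ∫ z, (‖u n z - F z‖ + ‖u m z - F z‖) :=
          integral_mono hint.norm (((huint n).sub hFint).norm.add ((huint m).sub hFint).norm) fun z ↦ by
            calc ‖u n z - u m z‖ = ‖(u n z - F z) - (u m z - F z)‖ := by rw [sub_sub_sub_cancel_right]
              _ ≤ _ := norm_sub_le _ _
      _ = _ := integral_add ((huint n).sub hFint).norm ((huint m).sub hFint).norm
  have hcauchy : UniformCauchySeqOn u atTop (closedBall z₀ (2 * R)) := by
    rw [Metric.uniformCauchySeqOn_iff]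
    intro ε hε
    obtain ⟨N₀, hN₀⟩ := (Metric.tendsto_atTop.1 hL1') (ε / (2 * C)) (by positivity)
    refine ⟨N₀, fun n hn m hm x hx ↦ ?_⟩
    rw [dist_eq_norm]
    have hn' := hN₀ n hn
    have hm' := hN₀ m hm
    rw [Real.dist_eq, sub_zero, abs_of_nonneg (integral_nonneg fun _ ↦ norm_nonneg _)] at hn' hm'
    calc ‖u n x - u m x‖ ≤ C * ((∫ z, ‖u n z - F z‖) + ∫ z, ‖u m z - F z‖) := hsup n m x hx
      _ < C * (ε / (2 * C) + ε / (2 * C)) := by gcongr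
      _ = ε := by field_simp; ring
  -- the limit function
  set g : (ι → ℂ) → ℂ := fun x ↦ limUnder atTop fun n ↦ u n x with hg
  have htend : ∀ x ∈ closedBall z₀ (2 * R), Tendsto (fun n ↦ u n x) atTop (𝓝 (g x)) := fun x hx ↦
    (hcauchy.cauchySeq hx).tendsto_limUnder
  have hunif : TendstoUniformlyOn u g atTop (closedBall z₀ (2 * R)) := hcauchy.tendstoUniformlyOn_of_tendsto htend
  have hghol : DifferentiableOn ℂ g (ball z₀ (2 * R)) :=
    SCV.differentiableOn_of_tendstoLocallyUniformlyOn isOpen_ball (fun n ↦ (hhol n).mono (ball_subset_ball (by linarith)))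
      (hunif.mono ball_subset_closedBall).tendstoLocallyUniformlyOn
  -- `f = g` a.e. on `B(z₀, R)`
  have hmeas : TendstoInMeasure volume u atTop F :=
    tendstoInMeasure_of_tendsto_eLpNorm one_ne_zero (fun n ↦ (huint n).aestronglyMeasurable) hFint.aestronglyMeasurable hL1
  obtain ⟨ns, hns, hae⟩ := hmeas.exists_seq_tendsto_ae
  refine ⟨g, hghol.mono (ball_subset_ball (by linarith)), ?_⟩
  filter_upwards [hae] with z hz hzR
  have hzK : z ∈ closedBall z₀ (2 * R) := closedBall_subset_closedBall (by linarith) (ball_subset_closedBall hzR)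
  have h1 : Tendsto (fun i ↦ u (ns i) z) atTop (𝓝 (g z)) := (htend z hzK).comp hns.tendsto_atTop
  have h2 : F z = g z := tendsto_nhds_unique hz h1
  have hz5 : z ∈ closedBall z₀ (5 * R / 2) := closedBall_subset_closedBall (by linarith) (ball_subset_closedBall hzR)
  rw [← h2, hFdef, indicator_of_mem hz5]

/-! ### Weyl's lemma on open sets -/

/-- **Weyl's lemma for `∂̄` in `ℂ^ι` (open sets).** If `U ⊆ ℂ^ι` is open and `f` is locally
integrable on `U` with `∫ f · ∂̄_j φ dλ = 0` for all `j` and all smooth `φ` compactly supported in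
`U`, then `f = g` a.e. on `U` for one holomorphic `g` on `U`.
[cite: HormanderSCV1973, §4.2 (Cor. 4.2.6); ALPDO I Thm 4.4.1] -/
theorem weyl_dbar_scv {U : Set (ι → ℂ)} (hU : IsOpen U) {f : (ι → ℂ) → ℂ} (hf : LocallyIntegrableOn f U)
    (h : ∀ φ : (ι → ℂ) → ℂ, ContDiff ℝ ∞ φ → HasCompactSupport φ → tsupport φ ⊆ U →
      ∀ j, ∫ z, f z * dbarAlong (Pi.single j 1) φ z = 0) :
    ∃ g : (ι → ℂ) → ℂ, DifferentiableOn ℂ g U ∧ ∀ᵐ z ∂volume, z ∈ U → f z = g z := by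
  classical
  have hloc : ∀ x : U, ∃ R : ℝ, 0 < R ∧ closedBall (x : ι → ℂ) (3 * R) ⊆ U ∧
      ∃ g : (ι → ℂ) → ℂ, DifferentiableOn ℂ g (ball (x : ι → ℂ) (3 * R / 2)) ∧
        ∀ᵐ z ∂volume, z ∈ ball (x : ι → ℂ) R → f z = g z := by
    rintro ⟨x, hx⟩
    obtain ⟨ε, hε, hεU⟩ := Metric.isOpen_iff.1 hU x hx
    have hsub : closedBall x (3 * (ε / 4)) ⊆ U := (closedBall_subset_ball (by linarith)).trans hεU
    refine ⟨ε / 4, by positivity, hsub, ?_⟩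
    exact weyl_dbar_scv_ball (by positivity) (hf.integrableOn_compact_subset hsub (isCompact_closedBall _ _))
      fun φ hφ hφc hφs ↦ h φ hφ hφc (hφs.trans hsub)
  choose R hR hRU gl hgl hae using hloc
  have hagree : ∀ x y : U, ∀ z ∈ ball (x : ι → ℂ) (R x) ∩ ball (y : ι → ℂ) (R y), gl x z = gl y z := by
    intro x y z hz
    have hV : IsOpen (ball (x : ι → ℂ) (R x) ∩ ball (y : ι → ℂ) (R y)) := isOpen_ball.inter isOpen_ball
    have hcx : ContinuousOn (gl x) (ball (x : ι → ℂ) (R x) ∩ ball (y : ι → ℂ) (R y)) :=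
      ((hgl x).mono ((inter_subset_left).trans (ball_subset_ball (by linarith [hR x])))).continuousOn
    have hcy : ContinuousOn (gl y) (ball (x : ι → ℂ) (R x) ∩ ball (y : ι → ℂ) (R y)) :=
      ((hgl y).mono ((inter_subset_right).trans (ball_subset_ball (by linarith [hR y])))).continuousOn
    have haexy : gl x =ᵐ[volume.restrict (ball (x : ι → ℂ) (R x) ∩ ball (y : ι → ℂ) (R y))] gl y := by
      rw [EventuallyEq, ae_restrict_iff' hV.measurableSet]
      filter_upwards [hae x, hae y] with w hwx hwy hw
      rw [← hwx hw.1, ← hwy hw.2]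
    exact Measure.eqOn_open_of_ae_eq haexy hV hcx hcy hz
  set g : (ι → ℂ) → ℂ := fun z ↦ if hz : z ∈ U then gl ⟨z, hz⟩ z else 0 with hg
  have hg_loc : ∀ x : U, ∀ z ∈ ball (x : ι → ℂ) (R x), g z = gl x z := by
    intro x z hz
    have hzU : z ∈ U := hRU x ((ball_subset_closedBall.trans
      (closedBall_subset_closedBall (by linarith [hR x]))) hz)
    simp only [hg, dif_pos hzU]
    exact hagree ⟨z, hzU⟩ x z ⟨mem_ball_self (hR _), hz⟩
  refine ⟨g, ?_, ?_⟩
  · intro z hz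
    have hball : ball z (R ⟨z, hz⟩) ∈ 𝓝 z := ball_mem_nhds z (hR _)
    have hev : g =ᶠ[𝓝 z] gl ⟨z, hz⟩ := by
      filter_upwards [hball] with w hw
      exact hg_loc ⟨z, hz⟩ w hw
    have hd : DifferentiableAt ℂ (gl ⟨z, hz⟩) z :=
      (hgl ⟨z, hz⟩).differentiableAt (ball_mem_nhds z (by linarith [hR ⟨z, hz⟩]))
    exact (hd.congr_of_eventuallyEq hev).differentiableWithinAt
  · -- countable subcover of `U` by the balls `ball x (R x)`
    obtain ⟨t, htU, htc, hcover⟩ := TopologicalSpace.countable_cover_nhdsWithin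
      (f := fun x : ι → ℂ ↦ if hx : x ∈ U then ball x (R ⟨x, hx⟩) else ∅) (s := U) (by
        intro x hx
        simp only [dif_pos hx]
        exact mem_nhdsWithin_of_mem_nhds (ball_mem_nhds x (hR _)))
    have hall : ∀ᵐ z ∂volume, ∀ x ∈ t, ∀ hx : x ∈ U, z ∈ ball x (R ⟨x, hx⟩) → f z = g z := by
      rw [ae_ball_iff htc]
      intro x hxt
      have hxU : x ∈ U := htU hxt
      filter_upwards [hae ⟨x, hxU⟩] with z hz hx' hzb
      rw [hz hzb, hg_loc ⟨x, hxU⟩ z hzb]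
    filter_upwards [hall] with z hz hzU
    obtain ⟨x, hxt, hzx⟩ : ∃ x ∈ t, z ∈ (if hx : x ∈ U then ball x (R ⟨x, hx⟩) else ∅) := by
      simpa only [mem_iUnion, exists_prop] using hcover hzU
    have hxU : x ∈ U := htU hxt
    rw [dif_pos hxU] at hzx
    exact hz x hxt hxU hzx

end WeylSCV

end Literature.Analysis.Complex
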